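import Literature.Analysis.OperatorTheory.SimilarityHeatSemigroupC0
import Literature.Analysis.UnboundedOperators.StrongContRepresentationConj
import Literature.Analysis.UnboundedOperators.SemigroupLaplaceResolventGenerator
import Mathlib.Analysis.Fourier.LpSpace
import HarnessLib

/-!
# The similarity heat semigroup `e^{τ(Δ + ½x·∇ + ½)}` on `L²(V; F)` and its resolvent
  (Jia–Šverák 2015, Lemma 2.1: `ρ(𝓛) ⊇ {Re λ > ½ − d/4}`, `= {Re λ > −¼}` for `d = 3`)

Analysis/OperatorTheory file (one definition with body, everything proved, no named facts):
the physical-side semigroup `S(τ) = 𝓕⁻¹ M_τ 𝓕` obtained from the Fourier-side C₀-semigroup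
`fourierSimilarityHeatSemigroup` (`SimilarityHeatSemigroupC0.lean`) by conjugation with
Mathlib's `L²` Fourier isometry `MeasureTheory.Lp.fourierTransformₗᵢ` (Plancherel), and the
consequences delivered by the Laplace bridge
(`Literature.Analysis.UnboundedOperators.C0Semigroup.laplaceResolvent`,
`isPseudoResolvent_laplaceResolvent`, `operatorOfResolvent_laplaceResolvent_eq_generator`):

* `similarityHeatSemigroupL2 : C0Semigroup ℂ (Lp F 2)` (**definition**) and its growth bound
  `‖S(τ)‖ ≤ e^{(½ − d/4)τ}` (`norm_similarityHeatSemigroupL2_app_le`);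
* `isPseudoResolvent_similarityHeat_resolvent`: the resolvent family
  `R(λ) = ∫₀^∞ e^{−λτ} S(τ) dτ` is a pseudo-resolvent on `{Re λ > ½ − d/4}`, whose closed
  operator is the generator of `S` (`operatorOfResolvent_similarityHeat_eq_generator`) — the
  Lean form of Jia–Šverák's Lemma 2.1 / the starting point "`σ(𝓛) ∩ {Re λ > −¼} = ∅` for the
  free part of `L_ss`" of Albritton–Brué–Colombo 2022, §2, to which the Riesz-projection /
  relatively-compact-perturbation calculus (`OperatorTheory.PseudoResolvent*`) now applies.

## References

* H. Jia, V. Šverák, J. Funct. Anal. 268 (2015), §2 Lemma 2.1. [JiaSverak2015]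
* D. Albritton, E. Brué, M. Colombo, Ann. of Math. 196 (2022), §2.2–2.3. [AlbrittonBrueColombo2022AnnMath]
* K.-J. Engel, R. Nagel (2000), Ch. II Thm. 1.10, §2.1. [EngelNagel2000]
-/

noncomputable section

open MeasureTheory Filter Topology
open scoped ENNReal NNReal

namespace Literature.Analysis.OperatorTheory

open Literature.Analysis.UnboundedOperators

variable {V : Type*} [NormedAddCommGroup V] [InnerProductSpace ℝ V] [FiniteDimensional ℝ V]
  [MeasurableSpace V] [BorelSpace V]
variable {F : Type*} [NormedAddCommGroup F] [InnerProductSpace ℂ F] [CompleteSpace F]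

/-- `2 ≠ ∞` in `ℝ≥0∞`. [folklore] -/
theorem two_ne_top' : (2 : ℝ≥0∞) ≠ ∞ := ENNReal.ofNat_ne_top

variable (V F) in
/-- **The similarity heat semigroup `S(τ) = e^{τ(Δ + ½x·∇ + ½)}` on `L²(V; F)`**, defined as
`𝓕⁻¹ M_τ 𝓕` with `M_τ` the explicit weighted dilation of `SimilarityHeatSemigroupFourier.lean`.
[cite: JiaSverak2015, §2 Lemma 2.1] -/
def similarityHeatSemigroupL2 : C0Semigroup ℂ (Lp F 2 (volume : Measure V)) :=
  (fourierSimilarityHeatSemigroup (V := V) (F := F) (p := 2) two_ne_top').conj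
    ((Lp.fourierTransformₗᵢ V F).symm.toContinuousLinearEquiv :
      Lp F 2 (volume : Measure V) ≃L[ℂ] Lp F 2 (volume : Measure V))

/-- `S(τ) = 𝓕⁻¹ ∘ M_τ ∘ 𝓕`. [cite: JiaSverak2015, §2 Lemma 2.1] -/
theorem similarityHeatSemigroupL2_app_apply (τ : ℝ≥0) (f : Lp F 2 (volume : Measure V)) :
    (similarityHeatSemigroupL2 V F).app τ f =
      (Lp.fourierTransformₗᵢ V F).symm
        (fourierSimilarityHeat two_ne_top' τ (Lp.fourierTransformₗᵢ V F f)) := by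
  rw [similarityHeatSemigroupL2, C0Semigroup.conj_app_apply, fourierSimilarityHeatSemigroup_app]
  rfl

/-- **Growth bound `‖S(τ)‖ ≤ 1 · e^{(½ − d/4)τ}`** (Plancherel + the Fourier-side bound; for
`d = 3`: `e^{−τ/4}`). [cite: JiaSverak2015, §2 Lemma 2.1] -/
theorem norm_similarityHeatSemigroupL2_app_le (τ : ℝ≥0) :
    ‖(similarityHeatSemigroupL2 V F).app τ‖ ≤
      1 * Real.exp ((1 / 2 - Module.finrank ℝ V / 4) * τ) := by
  have h := C0Semigroup.norm_conj_app_le_of_le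
    (fourierSimilarityHeatSemigroup (V := V) (F := F) (p := 2) two_ne_top')
    (Lp.fourierTransformₗᵢ V F).symm (norm_fourierSimilarityHeatSemigroup_app_le two_ne_top') τ
  refine h.trans (le_of_eq ?_)
  congr 2
  rw [ENNReal.toReal_ofNat]
  ring

/-- **Jia–Šverák, Lemma 2.1 (resolvent form)**: the Laplace-transform resolvent of the
similarity heat semigroup on `L²(V; F)` is a pseudo-resolvent on the half-plane
`{Re λ > ½ − d/4}`. [cite: JiaSverak2015, §2 Lemma 2.1] -/
theorem isPseudoResolvent_similarityHeat_resolvent :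
    IsPseudoResolvent {l : ℂ | 1 / 2 - (Module.finrank ℝ V : ℝ) / 4 < l.re}
      ((similarityHeatSemigroupL2 V F).laplaceResolvent
        (norm_similarityHeatSemigroupL2_app_le (V := V) (F := F))) :=
  C0Semigroup.isPseudoResolvent_laplaceResolvent _ _

/-- … and in dimension `3` the half-plane is `{Re λ > −¼}` ("`σ(𝓛) ⊆ {Re λ ≤ −¼}`").
[cite: JiaSverak2015, §2 Lemma 2.1] -/
theorem isPseudoResolvent_similarityHeat_resolvent_of_finrank_eq_three
    (hV : Module.finrank ℝ V = 3) :
    IsPseudoResolvent {l : ℂ | -(1 / 4 : ℝ) < l.re}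
      ((similarityHeatSemigroupL2 V F).laplaceResolvent
        (norm_similarityHeatSemigroupL2_app_le (V := V) (F := F))) := by
  have h := isPseudoResolvent_similarityHeat_resolvent (V := V) (F := F)
  have hset : {l : ℂ | 1 / 2 - (Module.finrank ℝ V : ℝ) / 4 < l.re} = {l : ℂ | -(1 / 4 : ℝ) < l.re} := by
    ext l
    simp only [Set.mem_setOf_eq, hV, Nat.cast_ofNat]
    constructor <;> intro hl <;> linarith
  rwa [hset] at h

/-- **The closed operator of the resolvent family is the generator** of `S` (Engel–Nagel
II.1.10 via the Laplace bridge): for `Re z₀ > ½ − d/4`,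
`operatorOfResolvent R z₀ = generator S`. [cite: EngelNagel2000, Ch. II Thm. 1.10] -/
theorem operatorOfResolvent_similarityHeat_eq_generator {z₀ : ℂ}
    (hz₀ : 1 / 2 - (Module.finrank ℝ V : ℝ) / 4 < z₀.re) :
    operatorOfResolvent ((similarityHeatSemigroupL2 V F).laplaceResolvent
        (norm_similarityHeatSemigroupL2_app_le (V := V) (F := F))) z₀
      (C0Semigroup.injective_laplaceResolvent _ _ hz₀) =
      (similarityHeatSemigroupL2 V F).generator :=
  C0Semigroup.operatorOfResolvent_laplaceResolvent_eq_generator _ _ hz₀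

end Literature.Analysis.OperatorTheory
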